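import Literature.MathematicalPhysics.QuantumFieldTheory.Balaban1983to89.Node00.BgSchemePrOfRecord
import Summits.QuantumFields.YangMills.Theorems.BalabanUVNodesN07ConstraintLogBridgePr
import HarnessLib

/-!
# N07 at the record — THE AVERAGE CONJUNCT OF THE KNIT TOKEN (rng) FOR THE (47)-CARRYING FRAMED SCHEME OF RECORD `bgSchemePrOfRecord`
# (def-Y (A4) ✓`Node00/BgSchemePrOfRecord`), BY NAME: framed form `avPrM 𝔥 ↑(𝔖.chartLin T^{pr} V A) = ↑V`, the un-framed average as the
# inverse-frame conjugate of `V`, and the K0ᴬ road's display `Ū^k(𝔖.chartLin T^{pr} V A) = V` verbatim wherever the frame is trivial on the chart field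

Cell `pub-ymgap`, seat `pub-ymgap-dag-n07-w3` (g28, WIDTH SEAT 3 on N07 [B11]); helper file keyed `--supports stmt-QuantumFields-27238 --as helper` (K0ᴬ road);
count-neutral.  INTENT-13 of the seat: the Summits-side steps 2–5 of the seat's CURE-SPEC (`CURE-SPEC-T47-CHART.g28.md`, evidence #13 on ⟨27238⟩) typed on the
letters of def-Y's (A4) — the re-keys OFFERED on the cell bus (18:14Z ∕ 18:24Z) once (A4) landed (✓p830859).

## What is here (all at the record's framed letters of (A2)–(A4); `𝔥 : FrameDatum (F.P K) N k U₀` a binder throughout)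

* §1 `readFun_Qpr_add_frakApr_of_eq_zero` — the LINEAR constraint of a chart coordinate: `Q^{pr}A = 0 ⟹ Q^{pr}(A + 𝔄^{pr}V) = B(V)` (T-Q^{pr}
  ✓`readFun_QprOfRecord_jet_eq_qPrCplxOp` + (A4) ✓`Qpr_frakAprOfRecordAtBg128`).
* §1 ★★★ `avPrM_chartLin_eq` — THE FRAMED AVERAGE CONJUNCT AT A CHART POINT: under the Sect. C `Regime` of the framed pair `(H₁^{pr}, C^{sl,pr})`, for
  `V ∈ logDiscOfRecord F N K k U₀`, `‖A + 𝔄^{pr}V‖ < a_C`, `Q^{pr}A = 0`, `T47(A + 𝔄^{pr}V)` traceless, `SU`-valued exponent and the A-side log-disc row: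
  `avPrM 𝔥 ↑(𝔖.chartLin (linPrOfRecord …) V A) = ↑V` ((A4) ✓`coeField_chartLin_eq_expOver` + this lineage's ✓`avPrM_T47_eq_of_logDisc` = (48) + the framed
  bridge ⟸ on the log-disc).
* §1 ★★ `coe_iter_chartLin_eq_frameConj` — + the chart field's matrices in the frame's window + the small-field guard below `k`:
  `↑(Ū^k(𝔖.chartLin … V A))(c) = h⁻¹(c₋)·V(c)·h(c₊)` (✓`iterMh_eq_frameConj_of_avPrM_eq`): the UN-FRAMED average of the framed chart point is `V`
  GAUGE-TRANSFORMED on the `k`-lattice by the inverse frame — the FRAME FLAG of the seat, at the chart.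
* §1 ★★★ `iter_chartLin_eq_of_map_eq_one` — + `𝔥.map ↑(chartLin …) = 1` (e.g. `FrameDatum.frameless`, by `rfl`): **`Averaging.iter (avOfRecord F N K) k
  (𝔖.chartLin (linPrOfRecord …) V A) = V`** — the K0ᴬ road's (rng) average conjunct VERBATIM (✓`…K0AxTangentSocketOntoOfKnitTokens{,ModGauge}`'s display).
* §2 (the fixed point `𝒜^{pr}(V) = 𝔖.sol V`, (star_mem)'s point): `sol_specPr` ((115) + fixed-point property, lit ✓`Regime.solA_mem`), `norm_solPr_le`,
  `norm_sol_add_frakApr_lt` (`‖𝒜^{pr} + 𝔄^{pr}‖ < a_C` when `ε₄ + a𝔄 ≤ a_C`), ★★ `readFun_Qpr_sol_eq_zero` ((109) `Q^{pr}𝒜^{pr}(V) = 0` from the solved form (116)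
  ✓`mapT_noLinear` and the framed slice row «`Q^{pr}𝔊^{pr} = 0`» DISPLAYED — the framed twin of `FrakGSliceTok`'s first clause is not yet a letter of the tree),
  ★★★ `avPrM_chartCfgLin_eq` and ★★★ `iter_chartCfgLin_eq_of_map_eq_one` — the two average conjuncts at `𝔖.chartCfgLin T^{pr} V` for `V ∈ curedDomPrOfRecord … a𝔄`
  (def-Y's cured domain supplies `‖𝔄^{pr}V‖ < a𝔄` AND the V-side log-disc row — LOCATED-g28-3's conjunct — by ✓`norm_frakApr_lt_of_mem_curedDomPrOfRecord` ∕
  ✓`curedDomPrOfRecord_subset_logDisc`).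

## Honest labels

Linear algebra and bookkeeping on landed letters; the Sect. C `Regime`, the scheme `Regime`, `‖J‖ ≤ j`, the framed slice row, the trace row, the `SU`-valuedness of the
exponent, the guard, the window membership and the A-side log-disc row are HYPOTHESES displayed, never asserted (print-true rows; the trace row is g27's
✓`trace_equiv_T47OfRecord_eq_zero_two` at `N = 2` frame-free, the guard∕window∕A-side rows follow from smallness by continuity — not typed here).  The frame flag stands:
at a non-trivial datum the framed chart point satisfies the FRAMED constraint, and the K0ᴬ road's un-framed display only up to the inverse-frame conjugation.
Nothing of Bałaban's estimates ((81), (98), (117)–(121) untouched); K0ᴬ ⟨27238⟩ NOT closed; N07 NOT discharged; R4 is the conditional finite-𝕋⁴ rung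
`BalabanLadder.UV` only; finite torus at fixed `ε` — nothing continuum ∕ OS ∕ Clay.  **The Yang–Mills mass gap is NOT proved by any of this.**
No `sorry`, no `def`, no `instance ∕ notation`; standard axioms.
[cite: Balaban1985Variational, (15) p.280, (20)–(21) p.281, (44)–(48) p.285, (103) p.293, (109)–(111) p.294, Prop. 6 (115)–(116) p.295; Balaban1985Averaging, (88) p.31, (92) p.31;
Balaban1985BackgroundPropagators, (3.113)–(3.115) p.418; Balaban1987RG1, (0.4) p.253, (0.21) p.256]
-/

set_option autoImplicit false

noncomputable section

open scoped Matrix Matrix.Norms.L2Operator InnerProductSpace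

namespace Summit.QuantumFields.YangMills.Theorems.N07ChartLinAverageAtRecord

open Literature.MathematicalPhysics.QuantumFieldTheory.Balaban1983to89
open Literature.MathematicalPhysics.QuantumFieldTheory.Balaban1983to89.T4Continuum (T4Family)
open Literature.MathematicalPhysics.QuantumFieldTheory.Balaban1983to89.Node00
open B15AveragingHolomorphic (iterMh)
open B11Eq103H1Complex (SiteL2K BondL2K readFun)
open B11Eq111FrakG (nabla115)
open B11Eq115Space (NegSize NegSup JetSup)
open B11Eq174Chart (Regime solA)
open B11Prop6Scheme (mapT mapT_noLinear)
open B11Eq90V0GroupComposed (T47)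
open Summit.QuantumFields.YangMills.Theorems.N07ConstraintLogBridgePr (readFun_QprOfRecord_jet_eq_qPrCplxOp avPrM_T47_eq_of_logDisc iterMh_eq_frameConj_of_avPrM_eq)

section Record

variable (F : T4Family) (N : ℕ) [NeZero N] (K : ℕ) (k : ℕ) (Ω : ℕ → Set (Site (F.P K) 0)) (U₀ : GaugeField (F.P K) 0 (SU N))
  [Fact (0 < (F.L : ℝ))] [Fact (0 < (F.P K).eta k)] [Fact (0 < c0Rec F K k)] [Fact (∀ c, 0 < wBRec F K k c)]
  (𝔥 : FrameDatum (F.P K) N k U₀) (dom : Set (GaugeField (F.P K) k (SU N))) (levB : PBond (F.P K) k → ℕ)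
  (Gp : SiteL2K ℂ (F.P K).d (fun _ => (F.P K).sitesPerDir 0) (c0Rec F K k) (WRec N) →ₗ[ℂ]
    SiteL2K ℂ (F.P K).d (fun _ => (F.P K).sitesPerDir 0) (c0Rec F K k) (WRec N))
  (Δ2 : BondL2K ℂ (F.P K).d (fun _ => (F.P K).sitesPerDir 0) (c0Rec F K k) (WRec N) →ₗ[ℂ]
    BondL2K ℂ (F.P K).d (fun _ => (F.P K).sitesPerDir 0) (c0Rec F K k) (WRec N)) (a : ℝ)
  (hposπ : ∀ x, x ≠ 0 → 0 < RCLike.re ⟪x, laplaceAOfRecordAt F N k U₀ (hessOpOfRecord128 F N k U₀ Gp (QprimeOfRecord F N k U₀) Δ2)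
    (QprOfRecord F N k U₀ 𝔥) (QprimeOfRecord F N k U₀) a x⟫_ℂ)
  (hposb : ∀ x, x ≠ 0 → 0 < RCLike.re ⟪x, laplaceAOfRecord F N k U₀ (QprOfRecord F N k U₀ 𝔥) (QprimeOfRecord F N k U₀) a x⟫_ℂ)
  (hQ : Function.Surjective (QprOfRecord F N k U₀ 𝔥)) (εC B₀ C₄ a₃ j a𝔄 ε₄ : ℝ)

/-- ★ **THE LINEAR CONSTRAINT OF A CHART COORDINATE**: `Q^{pr}A = 0 ⟹ Q^{pr}(A + 𝔄^{pr}V) = B(V)` (T-Q^{pr} linearity + (A4) `Qpr_frakAprOfRecordAtBg128`). -/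
theorem readFun_Qpr_add_frakApr_of_eq_zero (V : GaugeField (F.P K) k (SU N)) {A : Space115Lit F N K k Ω U₀}
    (hQA : readFun (phiRec N) _ (wBRec F K k) (QprOfRecord F N k U₀ 𝔥) (JetSup.equiv _ _ (nabla115 ((F.P K).eta k) (unitsOfRecord F N U₀)) A) = 0) :
    readFun (phiRec N) _ (wBRec F K k) (QprOfRecord F N k U₀ 𝔥)
        (JetSup.equiv _ _ (nabla115 ((F.P K).eta k) (unitsOfRecord F N U₀)) (A + frakAprOfRecordAtBg128 F N K k Ω U₀ 𝔥 levB Gp Δ2 a hposπ hQ V)) =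
      NegSup.equiv _ _ (BOfRecord F N K k U₀ levB V) := by
  rw [readFun_QprOfRecord_jet_eq_qPrCplxOp, map_add, map_add, ← readFun_QprOfRecord_jet_eq_qPrCplxOp, ← readFun_QprOfRecord_jet_eq_qPrCplxOp, hQA, zero_add,
    Qpr_frakAprOfRecordAtBg128]

/-- ★★★ **THE FRAMED (rng) AVERAGE CONJUNCT AT A CHART POINT OF THE (47)-CARRYING FRAMED SCHEME OF RECORD**: `avPrM 𝔥 ↑(𝔖.chartLin T^{pr} V A) = ↑V`. -/
theorem avPrM_chartLin_eq {b C₂ c₄ aC : ℝ}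
    (RC : Regime (H1prOfRecordAtBg F N K k Ω U₀ 𝔥 levB a hposb hQ) (0 : Space115Lit F N K k Ω U₀ →L[ℂ] Space115Lit F N K k Ω U₀)
      (CslprOfRecord F N K k Ω U₀ 𝔥 levB) b 0 C₂ c₄ 0 aC εC)
    {V : GaugeField (F.P K) k (SU N)} (hV : V ∈ logDiscOfRecord F N K k U₀) {A : Space115Lit F N K k Ω U₀}
    (hA : ‖A + frakAprOfRecordAtBg128 F N K k Ω U₀ 𝔥 levB Gp Δ2 a hposπ hQ V‖ < aC)
    (hQA : readFun (phiRec N) _ (wBRec F K k) (QprOfRecord F N k U₀ 𝔥) (JetSup.equiv _ _ (nabla115 ((F.P K).eta k) (unitsOfRecord F N U₀)) A) = 0)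
    (htr : ∀ b', (JetSup.equiv _ _ (nabla115 ((F.P K).eta k) (unitsOfRecord F N U₀))
        (T47 (H1prOfRecordAtBg F N K k Ω U₀ 𝔥 levB a hposb hQ) (CslprOfRecord F N K k Ω U₀ 𝔥 levB) εC
          (A + frakAprOfRecordAtBg128 F N K k Ω U₀ 𝔥 levB Gp Δ2 a hposπ hQ V)) b').trace = 0)
    (hSU : ∀ b', (bgSchemePrOfRecord F N K k Ω U₀ 𝔥 dom levB Gp Δ2 a hposπ hposb hQ εC B₀ C₄ a₃ j a𝔄 ε₄).expoLinAt
      (linPrOfRecord F N K k Ω U₀ 𝔥 levB a hposb hQ εC) V A b' ∈ Matrix.specialUnitaryGroup (Fin N) ℂ)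
    (hdiscA : ∀ c, ‖avPrM 𝔥 (coeField ((bgSchemePrOfRecord F N K k Ω U₀ 𝔥 dom levB Gp Δ2 a hposπ hposb hQ εC B₀ C₄ a₃ j a𝔄 ε₄).chartLin
        (linPrOfRecord F N K k Ω U₀ 𝔥 levB a hposb hQ εC) V A)) c * star (Averaging.iter (avOfRecord F N K) k U₀ c : Matrix (Fin N) (Fin N) ℂ) - 1‖ < 1) :
    avPrM 𝔥 (coeField ((bgSchemePrOfRecord F N K k Ω U₀ 𝔥 dom levB Gp Δ2 a hposπ hposb hQ εC B₀ C₄ a₃ j a𝔄 ε₄).chartLin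
        (linPrOfRecord F N K k Ω U₀ 𝔥 levB a hposb hQ εC) V A)) = coeField V := by
  rw [coeField_chartLin_eq_expOver F N K k Ω U₀ 𝔥 dom levB Gp Δ2 a hposπ hposb hQ εC B₀ C₄ a₃ j a𝔄 ε₄ V A hSU] at hdiscA ⊢
  exact avPrM_T47_eq_of_logDisc F N K k Ω U₀ 𝔥 levB a hposb hQ RC hA
    (readFun_Qpr_add_frakApr_of_eq_zero F N K k Ω U₀ 𝔥 levB Gp Δ2 a hposπ hQ V hQA) htr hdiscA ((mem_logDiscOfRecord_iff F N K k U₀ V).1 hV)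

/-- ★★ **THE UN-FRAMED AVERAGE OF THE FRAMED CHART POINT IS THE INVERSE-FRAME CONJUGATE OF `V`** (the frame flag at the chart): under the guard below `k` for the
chart field and with its matrices in the frame's window, `↑(Ū^k(𝔖.chartLin T^{pr} V A))(c) = h⁻¹(c₋)·V(c)·h(c₊)`. -/
theorem coe_iter_chartLin_eq_frameConj {b C₂ c₄ aC : ℝ}
    (RC : Regime (H1prOfRecordAtBg F N K k Ω U₀ 𝔥 levB a hposb hQ) (0 : Space115Lit F N K k Ω U₀ →L[ℂ] Space115Lit F N K k Ω U₀)
      (CslprOfRecord F N K k Ω U₀ 𝔥 levB) b 0 C₂ c₄ 0 aC εC)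
    {V : GaugeField (F.P K) k (SU N)} (hV : V ∈ logDiscOfRecord F N K k U₀) {A : Space115Lit F N K k Ω U₀}
    (hA : ‖A + frakAprOfRecordAtBg128 F N K k Ω U₀ 𝔥 levB Gp Δ2 a hposπ hQ V‖ < aC)
    (hQA : readFun (phiRec N) _ (wBRec F K k) (QprOfRecord F N k U₀ 𝔥) (JetSup.equiv _ _ (nabla115 ((F.P K).eta k) (unitsOfRecord F N U₀)) A) = 0)
    (htr : ∀ b', (JetSup.equiv _ _ (nabla115 ((F.P K).eta k) (unitsOfRecord F N U₀))
        (T47 (H1prOfRecordAtBg F N K k Ω U₀ 𝔥 levB a hposb hQ) (CslprOfRecord F N K k Ω U₀ 𝔥 levB) εC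
          (A + frakAprOfRecordAtBg128 F N K k Ω U₀ 𝔥 levB Gp Δ2 a hposπ hQ V)) b').trace = 0)
    (hSU : ∀ b', (bgSchemePrOfRecord F N K k Ω U₀ 𝔥 dom levB Gp Δ2 a hposπ hposb hQ εC B₀ C₄ a₃ j a𝔄 ε₄).expoLinAt
      (linPrOfRecord F N K k Ω U₀ 𝔥 levB a hposb hQ εC) V A b' ∈ Matrix.specialUnitaryGroup (Fin N) ℂ)
    (hW : coeField ((bgSchemePrOfRecord F N K k Ω U₀ 𝔥 dom levB Gp Δ2 a hposπ hposb hQ εC B₀ C₄ a₃ j a𝔄 ε₄).chartLin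
        (linPrOfRecord F N K k Ω U₀ 𝔥 levB a hposb hQ εC) V A) ∈ 𝔥.dom)
    (hguard : SmallBelow (avOfRecord F N K) k ((bgSchemePrOfRecord F N K k Ω U₀ 𝔥 dom levB Gp Δ2 a hposπ hposb hQ εC B₀ C₄ a₃ j a𝔄 ε₄).chartLin
        (linPrOfRecord F N K k Ω U₀ 𝔥 levB a hposb hQ εC) V A))
    (hdiscA : ∀ c, ‖avPrM 𝔥 (coeField ((bgSchemePrOfRecord F N K k Ω U₀ 𝔥 dom levB Gp Δ2 a hposπ hposb hQ εC B₀ C₄ a₃ j a𝔄 ε₄).chartLin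
        (linPrOfRecord F N K k Ω U₀ 𝔥 levB a hposb hQ εC) V A)) c * star (Averaging.iter (avOfRecord F N K) k U₀ c : Matrix (Fin N) (Fin N) ℂ) - 1‖ < 1)
    (c : PBond (F.P K) k) :
    (Averaging.iter (avOfRecord F N K) k ((bgSchemePrOfRecord F N K k Ω U₀ 𝔥 dom levB Gp Δ2 a hposπ hposb hQ εC B₀ C₄ a₃ j a𝔄 ε₄).chartLin
        (linPrOfRecord F N K k Ω U₀ 𝔥 levB a hposb hQ εC) V A) c : Matrix (Fin N) (Fin N) ℂ) =
      𝔥.inv (coeField ((bgSchemePrOfRecord F N K k Ω U₀ 𝔥 dom levB Gp Δ2 a hposπ hposb hQ εC B₀ C₄ a₃ j a𝔄 ε₄).chartLin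
          (linPrOfRecord F N K k Ω U₀ 𝔥 levB a hposb hQ εC) V A)) c.src * (V c : Matrix (Fin N) (Fin N) ℂ) *
        𝔥.map (coeField ((bgSchemePrOfRecord F N K k Ω U₀ 𝔥 dom levB Gp Δ2 a hposπ hposb hQ εC B₀ C₄ a₃ j a𝔄 ε₄).chartLin
          (linPrOfRecord F N K k Ω U₀ 𝔥 levB a hposb hQ εC) V A)) c.tgt := by
  have h := avPrM_chartLin_eq F N K k Ω U₀ 𝔥 dom levB Gp Δ2 a hposπ hposb hQ εC B₀ C₄ a₃ j a𝔄 ε₄ RC hV hA hQA htr hSU hdiscA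
  rw [← iterMh_eq_frameConj_of_avPrM_eq F N K k U₀ 𝔥 hW h c, iterMh_coeField_of_smallBelow F N k _ hguard, coeField_apply]

/-- ★★★ **(rng)'s DISPLAY VERBATIM WHERE THE FRAME IS TRIVIAL ON THE CHART FIELD** — in particular at the frameless datum (`FrameDatum.frameless_map`, window `univ`):
`Ū^k(𝔖.chartLin T^{pr} V A) = V`. -/
theorem iter_chartLin_eq_of_map_eq_one {b C₂ c₄ aC : ℝ}
    (RC : Regime (H1prOfRecordAtBg F N K k Ω U₀ 𝔥 levB a hposb hQ) (0 : Space115Lit F N K k Ω U₀ →L[ℂ] Space115Lit F N K k Ω U₀)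
      (CslprOfRecord F N K k Ω U₀ 𝔥 levB) b 0 C₂ c₄ 0 aC εC)
    {V : GaugeField (F.P K) k (SU N)} (hV : V ∈ logDiscOfRecord F N K k U₀) {A : Space115Lit F N K k Ω U₀}
    (hA : ‖A + frakAprOfRecordAtBg128 F N K k Ω U₀ 𝔥 levB Gp Δ2 a hposπ hQ V‖ < aC)
    (hQA : readFun (phiRec N) _ (wBRec F K k) (QprOfRecord F N k U₀ 𝔥) (JetSup.equiv _ _ (nabla115 ((F.P K).eta k) (unitsOfRecord F N U₀)) A) = 0)
    (htr : ∀ b', (JetSup.equiv _ _ (nabla115 ((F.P K).eta k) (unitsOfRecord F N U₀))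
        (T47 (H1prOfRecordAtBg F N K k Ω U₀ 𝔥 levB a hposb hQ) (CslprOfRecord F N K k Ω U₀ 𝔥 levB) εC
          (A + frakAprOfRecordAtBg128 F N K k Ω U₀ 𝔥 levB Gp Δ2 a hposπ hQ V)) b').trace = 0)
    (hSU : ∀ b', (bgSchemePrOfRecord F N K k Ω U₀ 𝔥 dom levB Gp Δ2 a hposπ hposb hQ εC B₀ C₄ a₃ j a𝔄 ε₄).expoLinAt
      (linPrOfRecord F N K k Ω U₀ 𝔥 levB a hposb hQ εC) V A b' ∈ Matrix.specialUnitaryGroup (Fin N) ℂ)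
    (hW : coeField ((bgSchemePrOfRecord F N K k Ω U₀ 𝔥 dom levB Gp Δ2 a hposπ hposb hQ εC B₀ C₄ a₃ j a𝔄 ε₄).chartLin
        (linPrOfRecord F N K k Ω U₀ 𝔥 levB a hposb hQ εC) V A) ∈ 𝔥.dom)
    (hmap : 𝔥.map (coeField ((bgSchemePrOfRecord F N K k Ω U₀ 𝔥 dom levB Gp Δ2 a hposπ hposb hQ εC B₀ C₄ a₃ j a𝔄 ε₄).chartLin
        (linPrOfRecord F N K k Ω U₀ 𝔥 levB a hposb hQ εC) V A)) = 1)
    (hguard : SmallBelow (avOfRecord F N K) k ((bgSchemePrOfRecord F N K k Ω U₀ 𝔥 dom levB Gp Δ2 a hposπ hposb hQ εC B₀ C₄ a₃ j a𝔄 ε₄).chartLin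
        (linPrOfRecord F N K k Ω U₀ 𝔥 levB a hposb hQ εC) V A))
    (hdiscA : ∀ c, ‖avPrM 𝔥 (coeField ((bgSchemePrOfRecord F N K k Ω U₀ 𝔥 dom levB Gp Δ2 a hposπ hposb hQ εC B₀ C₄ a₃ j a𝔄 ε₄).chartLin
        (linPrOfRecord F N K k Ω U₀ 𝔥 levB a hposb hQ εC) V A)) c * star (Averaging.iter (avOfRecord F N K) k U₀ c : Matrix (Fin N) (Fin N) ℂ) - 1‖ < 1) :
    Averaging.iter (avOfRecord F N K) k ((bgSchemePrOfRecord F N K k Ω U₀ 𝔥 dom levB Gp Δ2 a hposπ hposb hQ εC B₀ C₄ a₃ j a𝔄 ε₄).chartLin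
        (linPrOfRecord F N K k Ω U₀ 𝔥 levB a hposb hQ εC) V A) = V := by
  set W := coeField ((bgSchemePrOfRecord F N K k Ω U₀ 𝔥 dom levB Gp Δ2 a hposπ hposb hQ εC B₀ C₄ a₃ j a𝔄 ε₄).chartLin
        (linPrOfRecord F N K k Ω U₀ 𝔥 levB a hposb hQ εC) V A) with hWdef
  have hinv : 𝔥.inv W = 1 := by
    have e := 𝔥.map_mul_inv W hW
    rwa [hmap, one_mul] at e
  funext c
  have e := coe_iter_chartLin_eq_frameConj F N K k Ω U₀ 𝔥 dom levB Gp Δ2 a hposπ hposb hQ εC B₀ C₄ a₃ j a𝔄 ε₄ RC hV hA hQA htr hSU hW hguard hdiscA c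
  rw [← hWdef, hinv, hmap, Pi.one_apply, Pi.one_apply, one_mul, mul_one] at e
  exact Subtype.ext e

/-! ## At the fixed point `𝒜^{pr}(V) = 𝔖.sol V` ((star_mem)'s point): the framed EL solved form, `Q^{pr}𝒜^{pr}(V) = 0`, and the average conjunct of `chartCfgLin` -/

section FixedPoint

/-- ★ **(115) + THE FIXED-POINT PROPERTY FOR THE FRAMED SCHEME**: `‖𝒜^{pr}(V)‖ ≤ ε₄` and `𝒜^{pr}(V)` is a fixed point of (116)'s map at the framed letters
(lit ✓`Regime.solA_mem`; the un-framed row is ✓`bgSchemeOfRecord_sol_spec`). -/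
theorem sol_specPr
    (R : Regime (frakGprOfRecordAtBg128 F N K k Ω U₀ 𝔥 Gp Δ2 a hposπ hQ) (0 : Space115Lit F N K k Ω U₀ →L[ℂ] Space115Lit F N K k Ω U₀)
      (WprOfRecordAt F N K k Ω U₀ 𝔥 levB a hposb hQ εC Gp) B₀ 0 C₄ a₃ j a𝔄 ε₄)
    (hJ : ‖JOfRecordAtBg F N K k Ω U₀‖ ≤ j) {V : GaugeField (F.P K) k (SU N)} (h𝔄 : ‖frakAprOfRecordAtBg128 F N K k Ω U₀ 𝔥 levB Gp Δ2 a hposπ hQ V‖ < a𝔄) :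
    ‖(bgSchemePrOfRecord F N K k Ω U₀ 𝔥 dom levB Gp Δ2 a hposπ hposb hQ εC B₀ C₄ a₃ j a𝔄 ε₄).sol V‖ ≤ ε₄ ∧
      mapT (frakGprOfRecordAtBg128 F N K k Ω U₀ 𝔥 Gp Δ2 a hposπ hQ) 0 (WprOfRecordAt F N K k Ω U₀ 𝔥 levB a hposb hQ εC Gp) (JOfRecordAtBg F N K k Ω U₀)
        (frakAprOfRecordAtBg128 F N K k Ω U₀ 𝔥 levB Gp Δ2 a hposπ hQ V) ((bgSchemePrOfRecord F N K k Ω U₀ 𝔥 dom levB Gp Δ2 a hposπ hposb hQ εC B₀ C₄ a₃ j a𝔄 ε₄).sol V)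
        = (bgSchemePrOfRecord F N K k Ω U₀ 𝔥 dom levB Gp Δ2 a hposπ hposb hQ εC B₀ C₄ a₃ j a𝔄 ε₄).sol V :=
  R.solA_mem hJ h𝔄

/-- ★ **`‖𝒜^{pr}(V)‖ ≤ ε₄`**. -/
theorem norm_solPr_le
    (R : Regime (frakGprOfRecordAtBg128 F N K k Ω U₀ 𝔥 Gp Δ2 a hposπ hQ) (0 : Space115Lit F N K k Ω U₀ →L[ℂ] Space115Lit F N K k Ω U₀)
      (WprOfRecordAt F N K k Ω U₀ 𝔥 levB a hposb hQ εC Gp) B₀ 0 C₄ a₃ j a𝔄 ε₄)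
    (hJ : ‖JOfRecordAtBg F N K k Ω U₀‖ ≤ j) {V : GaugeField (F.P K) k (SU N)} (h𝔄 : ‖frakAprOfRecordAtBg128 F N K k Ω U₀ 𝔥 levB Gp Δ2 a hposπ hQ V‖ < a𝔄) :
    ‖(bgSchemePrOfRecord F N K k Ω U₀ 𝔥 dom levB Gp Δ2 a hposπ hposb hQ εC B₀ C₄ a₃ j a𝔄 ε₄).sol V‖ ≤ ε₄ :=
  (sol_specPr F N K k Ω U₀ 𝔥 dom levB Gp Δ2 a hposπ hposb hQ εC B₀ C₄ a₃ j a𝔄 ε₄ R hJ h𝔄).1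

/-- ★ **`‖𝒜^{pr}(V) + 𝔄^{pr}(V)‖ < a_C`** whenever `ε₄ + a𝔄 ≤ a_C` (the Sect. C radius covers the scheme's ball + shift). -/
theorem norm_sol_add_frakApr_lt {aC : ℝ}
    (R : Regime (frakGprOfRecordAtBg128 F N K k Ω U₀ 𝔥 Gp Δ2 a hposπ hQ) (0 : Space115Lit F N K k Ω U₀ →L[ℂ] Space115Lit F N K k Ω U₀)
      (WprOfRecordAt F N K k Ω U₀ 𝔥 levB a hposb hQ εC Gp) B₀ 0 C₄ a₃ j a𝔄 ε₄)
    (hJ : ‖JOfRecordAtBg F N K k Ω U₀‖ ≤ j) {V : GaugeField (F.P K) k (SU N)} (h𝔄 : ‖frakAprOfRecordAtBg128 F N K k Ω U₀ 𝔥 levB Gp Δ2 a hposπ hQ V‖ < a𝔄)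
    (haC : ε₄ + a𝔄 ≤ aC) :
    ‖(bgSchemePrOfRecord F N K k Ω U₀ 𝔥 dom levB Gp Δ2 a hposπ hposb hQ εC B₀ C₄ a₃ j a𝔄 ε₄).sol V +
        frakAprOfRecordAtBg128 F N K k Ω U₀ 𝔥 levB Gp Δ2 a hposπ hQ V‖ < aC :=
  lt_of_lt_of_le (lt_of_le_of_lt (norm_add_le _ _) (by linarith [norm_solPr_le F N K k Ω U₀ 𝔥 dom levB Gp Δ2 a hposπ hposb hQ εC B₀ C₄ a₃ j a𝔄 ε₄ R hJ h𝔄])) haC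

/-- ★★ **(109) FOR THE FRAMED FIXED POINT: `Q^{pr}𝒜^{pr}(V) = 0`** — by the solved form (116) and the framed slice row «`Q^{pr}𝔊^{pr} = 0`» DISPLAYED as a hypothesis
(the framed twin of `FrakGSliceTok`'s first clause; not yet a letter of the tree). -/
theorem readFun_Qpr_sol_eq_zero
    (R : Regime (frakGprOfRecordAtBg128 F N K k Ω U₀ 𝔥 Gp Δ2 a hposπ hQ) (0 : Space115Lit F N K k Ω U₀ →L[ℂ] Space115Lit F N K k Ω U₀)
      (WprOfRecordAt F N K k Ω U₀ 𝔥 levB a hposb hQ εC Gp) B₀ 0 C₄ a₃ j a𝔄 ε₄)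
    (hJ : ‖JOfRecordAtBg F N K k Ω U₀‖ ≤ j) {V : GaugeField (F.P K) k (SU N)} (h𝔄 : ‖frakAprOfRecordAtBg128 F N K k Ω U₀ 𝔥 levB Gp Δ2 a hposπ hQ V‖ < a𝔄)
    (h𝔊 : ∀ f, readFun (phiRec N) _ (wBRec F K k) (QprOfRecord F N k U₀ 𝔥)
      (JetSup.equiv _ _ (nabla115 ((F.P K).eta k) (unitsOfRecord F N U₀)) (frakGprOfRecordAtBg128 F N K k Ω U₀ 𝔥 Gp Δ2 a hposπ hQ f)) = 0) :
    readFun (phiRec N) _ (wBRec F K k) (QprOfRecord F N k U₀ 𝔥)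
      (JetSup.equiv _ _ (nabla115 ((F.P K).eta k) (unitsOfRecord F N U₀))
        ((bgSchemePrOfRecord F N K k Ω U₀ 𝔥 dom levB Gp Δ2 a hposπ hposb hQ εC B₀ C₄ a₃ j a𝔄 ε₄).sol V)) = 0 := by
  have h := (sol_specPr F N K k Ω U₀ 𝔥 dom levB Gp Δ2 a hposπ hposb hQ εC B₀ C₄ a₃ j a𝔄 ε₄ R hJ h𝔄).2
  rw [mapT_noLinear] at h
  rw [← h, readFun_QprOfRecord_jet_eq_qPrCplxOp, map_sub, map_neg, map_sub, map_neg, ← readFun_QprOfRecord_jet_eq_qPrCplxOp,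
    ← readFun_QprOfRecord_jet_eq_qPrCplxOp, h𝔊, h𝔊, neg_zero, sub_zero]

/-- ★★★ **THE FRAMED (rng) AVERAGE CONJUNCT AT THE FIXED POINT** (`(star_mem)`'s point, `Kc V ∋ 𝒜^{pr}(V)`): `avPrM 𝔥 ↑(𝔖.chartCfgLin T^{pr} V) = ↑V`. -/
theorem avPrM_chartCfgLin_eq {b C₂ c₄ aC : ℝ}
    (R : Regime (frakGprOfRecordAtBg128 F N K k Ω U₀ 𝔥 Gp Δ2 a hposπ hQ) (0 : Space115Lit F N K k Ω U₀ →L[ℂ] Space115Lit F N K k Ω U₀)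
      (WprOfRecordAt F N K k Ω U₀ 𝔥 levB a hposb hQ εC Gp) B₀ 0 C₄ a₃ j a𝔄 ε₄)
    (hJ : ‖JOfRecordAtBg F N K k Ω U₀‖ ≤ j)
    (h𝔊 : ∀ f, readFun (phiRec N) _ (wBRec F K k) (QprOfRecord F N k U₀ 𝔥)
      (JetSup.equiv _ _ (nabla115 ((F.P K).eta k) (unitsOfRecord F N U₀)) (frakGprOfRecordAtBg128 F N K k Ω U₀ 𝔥 Gp Δ2 a hposπ hQ f)) = 0)
    (RC : Regime (H1prOfRecordAtBg F N K k Ω U₀ 𝔥 levB a hposb hQ) (0 : Space115Lit F N K k Ω U₀ →L[ℂ] Space115Lit F N K k Ω U₀)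
      (CslprOfRecord F N K k Ω U₀ 𝔥 levB) b 0 C₂ c₄ 0 aC εC)
    (haC : ε₄ + a𝔄 ≤ aC)
    {V : GaugeField (F.P K) k (SU N)} (hV : V ∈ curedDomPrOfRecord F N K k Ω U₀ 𝔥 levB Gp Δ2 a hposπ hQ a𝔄)
    (htr : ∀ b', (JetSup.equiv _ _ (nabla115 ((F.P K).eta k) (unitsOfRecord F N U₀))
        (T47 (H1prOfRecordAtBg F N K k Ω U₀ 𝔥 levB a hposb hQ) (CslprOfRecord F N K k Ω U₀ 𝔥 levB) εC
          ((bgSchemePrOfRecord F N K k Ω U₀ 𝔥 dom levB Gp Δ2 a hposπ hposb hQ εC B₀ C₄ a₃ j a𝔄 ε₄).sol V +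
            frakAprOfRecordAtBg128 F N K k Ω U₀ 𝔥 levB Gp Δ2 a hposπ hQ V)) b').trace = 0)
    (hSU : ∀ b', (bgSchemePrOfRecord F N K k Ω U₀ 𝔥 dom levB Gp Δ2 a hposπ hposb hQ εC B₀ C₄ a₃ j a𝔄 ε₄).expoLinAt
      (linPrOfRecord F N K k Ω U₀ 𝔥 levB a hposb hQ εC) V
        ((bgSchemePrOfRecord F N K k Ω U₀ 𝔥 dom levB Gp Δ2 a hposπ hposb hQ εC B₀ C₄ a₃ j a𝔄 ε₄).sol V) b' ∈ Matrix.specialUnitaryGroup (Fin N) ℂ)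
    (hdiscA : ∀ c, ‖avPrM 𝔥 (coeField ((bgSchemePrOfRecord F N K k Ω U₀ 𝔥 dom levB Gp Δ2 a hposπ hposb hQ εC B₀ C₄ a₃ j a𝔄 ε₄).chartCfgLin
        (linPrOfRecord F N K k Ω U₀ 𝔥 levB a hposb hQ εC) V)) c * star (Averaging.iter (avOfRecord F N K) k U₀ c : Matrix (Fin N) (Fin N) ℂ) - 1‖ < 1) :
    avPrM 𝔥 (coeField ((bgSchemePrOfRecord F N K k Ω U₀ 𝔥 dom levB Gp Δ2 a hposπ hposb hQ εC B₀ C₄ a₃ j a𝔄 ε₄).chartCfgLin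
        (linPrOfRecord F N K k Ω U₀ 𝔥 levB a hposb hQ εC) V)) = coeField V := by
  have h𝔄 := norm_frakApr_lt_of_mem_curedDomPrOfRecord F N K k Ω U₀ 𝔥 levB Gp Δ2 a hposπ hQ hV
  rw [← BgScheme.chartLin_sol] at hdiscA ⊢
  exact avPrM_chartLin_eq F N K k Ω U₀ 𝔥 dom levB Gp Δ2 a hposπ hposb hQ εC B₀ C₄ a₃ j a𝔄 ε₄ RC
    (curedDomPrOfRecord_subset_logDisc F N K k Ω U₀ 𝔥 levB Gp Δ2 a hposπ hQ a𝔄 hV)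
    (norm_sol_add_frakApr_lt F N K k Ω U₀ 𝔥 dom levB Gp Δ2 a hposπ hposb hQ εC B₀ C₄ a₃ j a𝔄 ε₄ R hJ h𝔄 haC)
    (readFun_Qpr_sol_eq_zero F N K k Ω U₀ 𝔥 dom levB Gp Δ2 a hposπ hposb hQ εC B₀ C₄ a₃ j a𝔄 ε₄ R hJ h𝔄 h𝔊) htr hSU hdiscA

/-- ★★★ **(rng) ∧ (star_mem)'s AVERAGE CONJUNCT VERBATIM AT THE FIXED POINT WHERE THE FRAME IS TRIVIAL** (e.g. the frameless datum):
`Ū^k(𝔖.chartCfgLin T^{pr} V) = V` on the cured domain. -/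
theorem iter_chartCfgLin_eq_of_map_eq_one {b C₂ c₄ aC : ℝ}
    (R : Regime (frakGprOfRecordAtBg128 F N K k Ω U₀ 𝔥 Gp Δ2 a hposπ hQ) (0 : Space115Lit F N K k Ω U₀ →L[ℂ] Space115Lit F N K k Ω U₀)
      (WprOfRecordAt F N K k Ω U₀ 𝔥 levB a hposb hQ εC Gp) B₀ 0 C₄ a₃ j a𝔄 ε₄)
    (hJ : ‖JOfRecordAtBg F N K k Ω U₀‖ ≤ j)
    (h𝔊 : ∀ f, readFun (phiRec N) _ (wBRec F K k) (QprOfRecord F N k U₀ 𝔥)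
      (JetSup.equiv _ _ (nabla115 ((F.P K).eta k) (unitsOfRecord F N U₀)) (frakGprOfRecordAtBg128 F N K k Ω U₀ 𝔥 Gp Δ2 a hposπ hQ f)) = 0)
    (RC : Regime (H1prOfRecordAtBg F N K k Ω U₀ 𝔥 levB a hposb hQ) (0 : Space115Lit F N K k Ω U₀ →L[ℂ] Space115Lit F N K k Ω U₀)
      (CslprOfRecord F N K k Ω U₀ 𝔥 levB) b 0 C₂ c₄ 0 aC εC)
    (haC : ε₄ + a𝔄 ≤ aC)
    {V : GaugeField (F.P K) k (SU N)} (hV : V ∈ curedDomPrOfRecord F N K k Ω U₀ 𝔥 levB Gp Δ2 a hposπ hQ a𝔄)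
    (htr : ∀ b', (JetSup.equiv _ _ (nabla115 ((F.P K).eta k) (unitsOfRecord F N U₀))
        (T47 (H1prOfRecordAtBg F N K k Ω U₀ 𝔥 levB a hposb hQ) (CslprOfRecord F N K k Ω U₀ 𝔥 levB) εC
          ((bgSchemePrOfRecord F N K k Ω U₀ 𝔥 dom levB Gp Δ2 a hposπ hposb hQ εC B₀ C₄ a₃ j a𝔄 ε₄).sol V +
            frakAprOfRecordAtBg128 F N K k Ω U₀ 𝔥 levB Gp Δ2 a hposπ hQ V)) b').trace = 0)
    (hSU : ∀ b', (bgSchemePrOfRecord F N K k Ω U₀ 𝔥 dom levB Gp Δ2 a hposπ hposb hQ εC B₀ C₄ a₃ j a𝔄 ε₄).expoLinAt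
      (linPrOfRecord F N K k Ω U₀ 𝔥 levB a hposb hQ εC) V
        ((bgSchemePrOfRecord F N K k Ω U₀ 𝔥 dom levB Gp Δ2 a hposπ hposb hQ εC B₀ C₄ a₃ j a𝔄 ε₄).sol V) b' ∈ Matrix.specialUnitaryGroup (Fin N) ℂ)
    (hW : coeField ((bgSchemePrOfRecord F N K k Ω U₀ 𝔥 dom levB Gp Δ2 a hposπ hposb hQ εC B₀ C₄ a₃ j a𝔄 ε₄).chartCfgLin
        (linPrOfRecord F N K k Ω U₀ 𝔥 levB a hposb hQ εC) V) ∈ 𝔥.dom)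
    (hmap : 𝔥.map (coeField ((bgSchemePrOfRecord F N K k Ω U₀ 𝔥 dom levB Gp Δ2 a hposπ hposb hQ εC B₀ C₄ a₃ j a𝔄 ε₄).chartCfgLin
        (linPrOfRecord F N K k Ω U₀ 𝔥 levB a hposb hQ εC) V)) = 1)
    (hguard : SmallBelow (avOfRecord F N K) k ((bgSchemePrOfRecord F N K k Ω U₀ 𝔥 dom levB Gp Δ2 a hposπ hposb hQ εC B₀ C₄ a₃ j a𝔄 ε₄).chartCfgLin
        (linPrOfRecord F N K k Ω U₀ 𝔥 levB a hposb hQ εC) V))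
    (hdiscA : ∀ c, ‖avPrM 𝔥 (coeField ((bgSchemePrOfRecord F N K k Ω U₀ 𝔥 dom levB Gp Δ2 a hposπ hposb hQ εC B₀ C₄ a₃ j a𝔄 ε₄).chartCfgLin
        (linPrOfRecord F N K k Ω U₀ 𝔥 levB a hposb hQ εC) V)) c * star (Averaging.iter (avOfRecord F N K) k U₀ c : Matrix (Fin N) (Fin N) ℂ) - 1‖ < 1) :
    Averaging.iter (avOfRecord F N K) k ((bgSchemePrOfRecord F N K k Ω U₀ 𝔥 dom levB Gp Δ2 a hposπ hposb hQ εC B₀ C₄ a₃ j a𝔄 ε₄).chartCfgLin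
        (linPrOfRecord F N K k Ω U₀ 𝔥 levB a hposb hQ εC) V) = V := by
  have h𝔄 := norm_frakApr_lt_of_mem_curedDomPrOfRecord F N K k Ω U₀ 𝔥 levB Gp Δ2 a hposπ hQ hV
  rw [← BgScheme.chartLin_sol] at hW hmap hguard hdiscA ⊢
  exact iter_chartLin_eq_of_map_eq_one F N K k Ω U₀ 𝔥 dom levB Gp Δ2 a hposπ hposb hQ εC B₀ C₄ a₃ j a𝔄 ε₄ RC
    (curedDomPrOfRecord_subset_logDisc F N K k Ω U₀ 𝔥 levB Gp Δ2 a hposπ hQ a𝔄 hV)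
    (norm_sol_add_frakApr_lt F N K k Ω U₀ 𝔥 dom levB Gp Δ2 a hposπ hposb hQ εC B₀ C₄ a₃ j a𝔄 ε₄ R hJ h𝔄 haC)
    (readFun_Qpr_sol_eq_zero F N K k Ω U₀ 𝔥 dom levB Gp Δ2 a hposπ hposb hQ εC B₀ C₄ a₃ j a𝔄 ε₄ R hJ h𝔄 h𝔊) htr hSU hW hmap hguard hdiscA

end FixedPoint

end Record

end Summit.QuantumFields.YangMills.Theorems.N07ChartLinAverageAtRecord

end
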